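import Mathlib
import Summits.Ventures.PercRepro2.HullPieceFlip
import Summits.Ventures.PercRepro2.LocRows2
import Summits.Ventures.PercRepro2.LocSym
import Summits.Ventures.PercRepro2.LocPairing
import Summits.Ventures.PercRepro2.LocPairingCombo
import Summits.Ventures.PercRepro2.PairingTrivialCore

/-!
# (PAIR-combo) when only the SOURCE configurations have a trivial core
(blind cell PercRepro2, night-4)

`PairingTrivialCore` assumed core `{l}` in every configuration. The same construction,
`τ ζ := blue (flipO ζ)`, only needs the hypothesis on the configurations of the source set
`M₀ = {h ∉ H_l, o ∈ B_side}` (`pairCombo_of_core_eq_src`), which holds for instance when `h` is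
adjacent to every vertex other than `l` (`core_eq_of_adj_all`, `pairCombo_of_adj_all`): a core
vertex `k ≠ l` would carry `h` into the red or the blue cluster of `l` through the edge `hk`.
-/

namespace Summit.Ventures.PercRepro2

namespace LocRows

open Hull

variable {V : Type*} {E : Type*} [Fintype E] [DecidableEq E]

open scoped Classical

variable {ends : E → Sym2 V} {l h o : V}

/-- The swap of the piece flip maps a source configuration with core `{l}` into the source set. -/
lemma blue_flipO_mem_src_of_core {ζ : Config E} (hK : core ends ζ l = {l})
    (hζ : ζ ∈ srcU ends l h {S : Set V | o ∈ S}) :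
    blue (flipO ends ζ l o) ∈ srcU ends l h {S : Set V | o ∈ S} := by
  rw [mem_src_principal] at hζ ⊢
  have hB : o ∈ bside ends ζ l := bside_of_mem_src hζ
  have hnc : NonCritRed ends (blue ζ) l (piece ends ζ l o) :=
    nonCritRed_of_core_eq (ζ := blue ζ) (by rw [core_blue]; exact hK) _
  obtain ⟨hR, -, -, hH, -⟩ := flipO_blue_case hB hnc
  refine ⟨?_, ?_, ?_⟩
  · rw [hull_blue, hH]; exact hζ.1
  · rw [blue_blue]; exact hR.1
  · exact hR.2

/-- On a source configuration with core `{l}` the swap of the piece flip is an involution. -/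
lemma blue_flipO_blue_flipO_of_core {ζ : Config E} (hK : core ends ζ l = {l})
    (hζ : ζ ∈ srcU ends l h {S : Set V | o ∈ S}) :
    blue (flipO ends (blue (flipO ends ζ l o)) l o) = ζ := by
  rw [mem_src_principal] at hζ
  have hg : Good ends ζ l o := (good_iff_of_core_eq hK).2 (Or.inr (bside_of_mem_src hζ))
  rw [flipO_blue, blue_blue]
  exact flipO_flipO hg

/-- The piece-confined clause between a source configuration with core `{l}` and the swap of its
piece flip. -/
lemma comboRel_blue_flipO_of_core {ζ : Config E} (hK : core ends ζ l = {l})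
    (hζ : ζ ∈ srcU ends l h {S : Set V | o ∈ S}) :
    ComboRel ends l o ζ (blue (flipO ends ζ l o)) := by
  rw [mem_src_principal] at hζ
  have hB : o ∈ bside ends ζ l := bside_of_mem_src hζ
  have hnc : NonCritRed ends (blue ζ) l (piece ends ζ l o) :=
    nonCritRed_of_core_eq (ζ := blue ζ) (by rw [core_blue]; exact hK) _
  have hp : piece ends (blue (flipO ends ζ l o)) l o = piece ends ζ l o := by
    rw [piece_blue]; exact (flipO_blue_case hB hnc).2.1
  refine ⟨fun e he => ?_, fun e he => ?_, fun e he => Or.inl (mem_touches_piece_of_agree he)⟩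
  · rw [hp, Set.inter_self] at he
    exact agree_of_mem_touches_piece he
  · obtain ⟨x, hx, y, hends⟩ := he
    rw [Set.mem_singleton_iff] at hx
    subst hx
    exact agree_of_mem_touches_piece ⟨x, mem_piece_self ζ l x, y, hends⟩

/-- **(PAIR-combo) when every source configuration has core `{l}`.** -/
theorem pairCombo_of_core_eq_src (ends : E → Sym2 V) (l h o : V)
    (hK : ∀ ζ ∈ srcU ends l h {S : Set V | o ∈ S}, core ends ζ l = {l}) : PairCombo ends l h o := by
  refine ⟨fun x => ⟨blue (flipO ends x.1 l o), blue_flipO_mem_src_of_core (hK x.1 x.2) x.2⟩, ?_, ?_⟩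
  · intro x
    exact Subtype.ext (blue_flipO_blue_flipO_of_core (hK x.1 x.2) x.2)
  · intro x
    exact ⟨pairRel_blue_flipO x.2, comboRel_blue_flipO_of_core (hK x.1 x.2) x.2⟩

/-! ## `h` adjacent to every vertex other than `l` -/

/-- If `h` is adjacent to every vertex other than `l`, a source configuration has core `{l}`: a core
vertex `k ≠ l` would carry `h` into the red or the blue cluster of `l` through the edge `hk`. -/
lemma core_eq_of_adj_all (hadj : ∀ k, k ≠ l → k ≠ h → ∃ e, ends e = s(h, k)) {ζ : Config E}
    (hζ : ζ ∈ srcU ends l h {S : Set V | o ∈ S}) : core ends ζ l = {l} := by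
  rw [mem_src_principal] at hζ
  apply Set.Subset.antisymm
  · intro k hk
    by_contra hkl
    rw [Set.mem_singleton_iff] at hkl
    have hkh : k ≠ h := fun hkh => hζ.1 (hkh ▸ Or.inl hk.1)
    obtain ⟨e, he⟩ := hadj k hkl hkh
    cases hc : ζ e with
    | true => exact hζ.1 (Or.inl (mem_cluster_of_edge hk.1 hc (ends_swap he)))
    | false =>
      exact hζ.1 (Or.inr (mem_cluster_of_edge hk.2 (blue_eq_true_iff.2 hc) (ends_swap he)))
  · intro k hk
    rw [Set.mem_singleton_iff] at hk
    subst hk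
    exact l_mem_core ζ k

/-- **(PAIR-combo) when `h` is adjacent to every vertex other than `l`.** -/
theorem pairCombo_of_adj_all (ends : E → Sym2 V) (l h o : V)
    (hadj : ∀ k, k ≠ l → k ≠ h → ∃ e, ends e = s(h, k)) : PairCombo ends l h o :=
  pairCombo_of_core_eq_src ends l h o (fun _ hζ => core_eq_of_adj_all hadj hζ)

end LocRows

end Summit.Ventures.PercRepro2
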